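import Summits.AtomisticToContinuum.BoseEinsteinCondensation.Theorems.FibreConductance.Negative.FibreVocabulary
import Summits.AtomisticToContinuum.BoseEinsteinCondensation.Theorems.BECThomsonPrincipleFibreFubini

/-!
# Crux `FibreConductance` (stmt-AtomisticToContinuum-9480) — infrared necessity I: bridge to the
# line's fibre interface, plane-wave bookkeeping

Crux disprover file (cdisprove cycle 3), first of the chain
`InfraredBridge → InfraredTestFunction → InfraredNecessity` proving INFRARED NECESSITY (the
structural fact "Disproof §D ⇒ single-mode occupation bounds next to the source mode" that every
seat on this crux quotes informally) as kernel-checked theorems.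

Here: (i) the crux's fibre objects `W, ψ, β` of `FibreVocabulary.lean` (functions of `Φ.ψ`) are
definitionally the line's bundled objects of `BECThomsonPrincipleDefs` (`psb_fibreW`, `psb_fibrePsi`,
`psb_fibreBeta`, all `rfl`), so the lead's regularity / Fubini interface
(`BECThomsonPrincipleFibreRegularity`, `BECThomsonPrincipleFibreFubini`) is re-exported in the crux's
vocabulary (primed names); (ii) plane-wave bookkeeping for the crux's phase `wave` (`|e_n| = 1`,
`e_ae_b = e_{a+b}`, periodicity, `C¹`, the fibre derivative `∂_{x_{0,l}}e_p(x₀) = (2πip_l/L)e_p(x₀)`),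
and the lemma that a FIBRE CONSTANT (a function of the bath `X̂` alone) has zero fibre derivative.
All [folklore].
-/

noncomputable section

namespace Summit.AtomisticToContinuum.BoseEinsteinCondensation.Theorems.FibreConductance.Negative

open MeasureTheory Literature.MathematicalPhysics.QuantumManyBody.BoseGas
open scoped ENNReal NNReal ComplexConjugate

variable {m : ℕ} {L : ℝ}

/-! ### Bridge to the line's fibre interface (`BECThomsonPrincipleDefs`: same objects, bundled state) -/

section Bridge

open Summit.AtomisticToContinuum.BoseEinsteinCondensation.Cruxes.FibreConductance

/-- The line's `fibreW` is the crux's `W`. [folklore] -/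
theorem psb_fibreW (Φ : PeriodicTrialState (m + 1) L) :
    ParsevalShellBootstrap.fibreW Φ = fibreW L Φ.ψ := rfl

/-- The line's `fibrePsi` is the crux's `ψ`. [folklore] -/
theorem psb_fibrePsi (Φ : PeriodicTrialState (m + 1) L) :
    ParsevalShellBootstrap.fibrePsi Φ = fibrePsi L Φ.ψ := rfl

/-- The line's `fibreBeta` is the crux's `β`. [folklore] -/
theorem psb_fibreBeta (n : Fin 3 → ℤ) (Φ : PeriodicTrialState (m + 1) L) :
    ParsevalShellBootstrap.fibreBeta n Φ = fibreBeta L n Φ.ψ := rfl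

variable (hL : 0 < L) (Φ : PeriodicTrialState (m + 1) L) (hΦ : ∀ X, Φ.ψ X ≠ 0)

include hL hΦ in
/-- `W > 0` (zero-free state). [folklore] -/
theorem fibreW_pos' (X : Config (m + 1)) : 0 < fibreW L Φ.ψ X :=
  ParsevalShellBootstrap.fibreW_pos hL Φ hΦ X

/-- `W ≥ 0`. [folklore] -/
theorem fibreW_nonneg' (X : Config (m + 1)) : 0 ≤ fibreW L Φ.ψ X :=
  ParsevalShellBootstrap.fibreW_nonneg Φ X

/-- `W` is periodic in every particle. [folklore] -/
theorem fibreW_periodic' (X : Config (m + 1)) (i : Fin (m + 1)) (k : Fin 3) :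
    fibreW L Φ.ψ (X + Pi.single i (EuclideanSpace.single k L)) = fibreW L Φ.ψ X :=
  ParsevalShellBootstrap.fibreW_periodic Φ X i k

/-- `W` is `C¹`. [folklore] -/
theorem contDiff_fibreW' : ContDiff ℝ 1 (fibreW L Φ.ψ) :=
  ParsevalShellBootstrap.contDiff_fibreW Φ

/-- `W` is continuous. [folklore] -/
theorem continuous_fibreW' : Continuous (fibreW L Φ.ψ) :=
  ParsevalShellBootstrap.continuous_fibreW Φ

/-- `W` is measurable. [folklore] -/
theorem measurable_fibreW' : Measurable (fibreW L Φ.ψ) :=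
  ParsevalShellBootstrap.measurable_fibreW Φ

include hL hΦ in
/-- `ψ > 0` (zero-free state). [folklore] -/
theorem fibrePsi_pos' (X : Config (m + 1)) : 0 < fibrePsi L Φ.ψ X :=
  ParsevalShellBootstrap.fibrePsi_pos hL Φ hΦ X

/-- `ψ` is periodic in every particle. [folklore] -/
theorem fibrePsi_periodic' (X : Config (m + 1)) (i : Fin (m + 1)) (k : Fin 3) :
    fibrePsi L Φ.ψ (X + Pi.single i (EuclideanSpace.single k L)) = fibrePsi L Φ.ψ X :=
  ParsevalShellBootstrap.fibrePsi_periodic Φ X i k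

include hL hΦ in
/-- `ψ` is `C¹`. [folklore] -/
theorem contDiff_fibrePsi' : ContDiff ℝ 1 (fibrePsi L Φ.ψ) :=
  ParsevalShellBootstrap.contDiff_fibrePsi hL Φ hΦ

include hL hΦ in
/-- `ψ` is continuous. [folklore] -/
theorem continuous_fibrePsi' : Continuous (fibrePsi L Φ.ψ) :=
  ParsevalShellBootstrap.continuous_fibrePsi hL Φ hΦ

include hL hΦ in
/-- `ψ` is measurable. [folklore] -/
theorem measurable_fibrePsi' : Measurable (fibrePsi L Φ.ψ) :=
  ParsevalShellBootstrap.measurable_fibrePsi hL Φ hΦ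

include hL hΦ in
/-- `∫_cell ψ(y|X̂)² dy = 1`. [folklore] -/
theorem integral_fibrePsi_sq' (X : Config (m + 1)) :
    ∫ y in cell L, fibrePsi L Φ.ψ (Function.update X 0 y) ^ 2 = 1 :=
  ParsevalShellBootstrap.integral_fibrePsi_sq hL Φ hΦ X

include hL in
/-- `β` is periodic in every particle. [folklore] -/
theorem fibreBeta_periodic' (n : Fin 3 → ℤ) (X : Config (m + 1)) (i : Fin (m + 1)) (k : Fin 3) :
    fibreBeta L n Φ.ψ (X + Pi.single i (EuclideanSpace.single k L)) = fibreBeta L n Φ.ψ X :=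
  ParsevalShellBootstrap.fibreBeta_periodic hL n Φ X i k

include hL hΦ in
/-- `β` is `C¹`. [folklore] -/
theorem contDiff_fibreBeta' (n : Fin 3 → ℤ) : ContDiff ℝ 1 (fibreBeta L n Φ.ψ) :=
  ParsevalShellBootstrap.contDiff_fibreBeta hL n Φ hΦ

include hL hΦ in
/-- `β` is continuous. [folklore] -/
theorem continuous_fibreBeta' (n : Fin 3 → ℤ) : Continuous (fibreBeta L n Φ.ψ) :=
  ParsevalShellBootstrap.continuous_fibreBeta hL n Φ hΦ

include hL in
/-- `β_p = L³ ĉ_{−p}(ψ(·|X̂))`. [folklore] -/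
theorem fibreBeta_eq_cellFourierCoeff' (n : Fin 3 → ℤ) (X : Config (m + 1)) :
    fibreBeta L n Φ.ψ X = ((L ^ 3 : ℝ) : ℂ) *
      cellFourierCoeff L (fun y => (fibrePsi L Φ.ψ (Function.update X 0 y) : ℂ)) (-n) :=
  ParsevalShellBootstrap.fibreBeta_eq_cellFourierCoeff hL n Φ X

include hL hΦ in
/-- `∫_{cell^N} W |ĉ_q(ψ(·|X̂))|² dX = n_q(|Φ|)/N` (the lead's fibre Fubini). [folklore] -/
theorem lintegral_fibreW_mul_norm_sq_cellFourierCoeff' (q : Fin 3 → ℤ) :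
    ∫⁻ X in cellN (m + 1) L, ENNReal.ofReal
        (fibreW L Φ.ψ X * ‖cellFourierCoeff L (fun y => (fibrePsi L Φ.ψ (Function.update X 0 y) : ℂ)) q‖ ^ 2) =
      cellOccupation (m + 1) L (planeWaveMode L q) (fun X => (‖Φ.ψ X‖ : ℂ)) / (m + 1 : ℝ≥0∞) :=
  ParsevalShellBootstrap.lintegral_fibreW_mul_norm_sq_cellFourierCoeff hL Φ hΦ q

include hL in
/-- Fibre Fubini for a fibre-constant weight (the lead's `lintegral_cellN_eq_fibre_average`). [folklore] -/
theorem lintegral_cellN_eq_fibre_average' {G : Config (m + 1) → ℝ≥0∞} (hG : Measurable G) :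
    ∫⁻ X in cellN (m + 1) L, G X =
      (ENNReal.ofReal (L ^ 3))⁻¹ * ∫⁻ X in cellN (m + 1) L, ∫⁻ y in cell L, G (Function.update X 0 y) :=
  ParsevalShellBootstrap.lintegral_cellN_eq_fibre_average hL hG

/-- The substitution `(y, X) ↦ X[0 ↦ y]` is `C¹`. [folklore] -/
theorem contDiff_update_zero' :
    ContDiff ℝ 1 fun q : Space × Config (m + 1) => Function.update q.2 0 q.1 :=
  ParsevalShellBootstrap.contDiff_update_zero

end Bridge

/-! ### Plane-wave bookkeeping -/

/-- `|e_n| = 1`. [folklore] -/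
theorem norm_wave (L : ℝ) (n : Fin 3 → ℤ) (y : Space) : ‖wave L n y‖ = 1 := by
  rw [wave_eq_cellWave, norm_cellWave]

/-- `e_a e_b = e_{a+b}`. [folklore] -/
theorem wave_mul_wave (L : ℝ) (a b : Fin 3 → ℤ) (y : Space) :
    wave L a y * wave L b y = wave L (a + b) y := by
  unfold wave
  rw [← Complex.exp_add]
  congr 1
  simp only [Pi.add_apply, Int.cast_add, add_mul, Finset.sum_add_distrib]
  push_cast
  ring

/-- `e_{n−e} = e_n e_{−e}`. [folklore] -/
theorem wave_sub (L : ℝ) (n e : Fin 3 → ℤ) (y : Space) :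
    wave L (n - e) y = wave L n y * wave L (-e) y := by
  rw [wave_mul_wave, ← sub_eq_add_neg]

/-- The plane waves are `Lℤ³`-periodic. [folklore] -/
theorem wave_periodic (hL : L ≠ 0) (n : Fin 3 → ℤ) (y : Space) (k : Fin 3) :
    wave L n (y + EuclideanSpace.single k L) = wave L n y := by
  rw [wave_eq_cellWave, wave_eq_cellWave, cellWave_periodic hL]

/-- The plane waves are `C¹`. [folklore] -/
theorem contDiff_wave (L : ℝ) (n : Fin 3 → ℤ) : ContDiff ℝ 1 (wave L n) := by
  have h : wave L n = cellWave L n := funext fun y => wave_eq_cellWave L n y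
  rw [h]
  exact (contDiff_cellWave L n).of_le (mod_cast le_top)

/-- `X ↦ e_p(x₀)` is differentiable. [folklore] -/
theorem differentiable_wave_comp_zero (L : ℝ) (p : Fin 3 → ℤ) :
    Differentiable ℝ fun Y : Config (m + 1) => wave L p (Y 0) :=
  ((contDiff_wave L p).differentiable one_ne_zero).comp (differentiable_apply (0 : Fin (m + 1)))

/-- **Fibre derivative of `e_p(x₀)`**: `∂_{x_{0,l}} e_p(x₀) = (2πi p_l/L) e_p(x₀)`. [folklore] -/
theorem fderiv_wave_comp_zero (L : ℝ) (p : Fin 3 → ℤ) (X : Config (m + 1)) (l : Fin 3) :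
    fderiv ℝ (fun Y : Config (m + 1) => wave L p (Y 0)) X (Pi.single 0 (EuclideanSpace.single l 1)) =
      (2 * Real.pi * Complex.I * (p l) / L) * wave L p (X 0) := by
  have hw : (fun Y : Config (m + 1) => wave L p (Y 0)) = cellWave L p ∘ fun Y : Config (m + 1) => Y 0 :=
    funext fun Y => wave_eq_cellWave L p (Y 0)
  have hcw : Differentiable ℝ (cellWave L p) :=
    ((contDiff_cellWave L p).of_le (mod_cast le_top) : ContDiff ℝ 1 (cellWave L p)).differentiable
      one_ne_zero
  rw [hw, fderiv_comp X (hcw _)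
    (differentiableAt_apply 0 X), (hasFDerivAt_apply (0 : Fin (m + 1)) X).fderiv,
    ContinuousLinearMap.comp_apply, ContinuousLinearMap.proj_apply, Pi.single_eq_same,
    fderiv_cellWave_apply_single, wave_eq_cellWave]

/-- Translating particle `0` is an update of the fibre variable. [folklore] -/
theorem add_single_zero_eq_update (X : Config (m + 1)) (v : Space) :
    X + Pi.single 0 v = Function.update X 0 (X 0 + v) := by
  funext j
  rcases eq_or_ne j 0 with rfl | hj
  · simp
  · simp [hj]

/-- **A fibre constant has zero fibre derivative**: if `G(X[0↦y]) = G(X)` for all `y` and `G` is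
differentiable at `X`, then `∂_{x_0} G(X) = 0` (the line derivative along `e₀ ⊗ u` of a function
constant on that line). [folklore] -/
theorem fderiv_single_zero_of_update_invariant {G : Config (m + 1) → ℂ}
    (hG : ∀ X y, G (Function.update X 0 y) = G X) {X : Config (m + 1)} (hd : DifferentiableAt ℝ G X)
    (u : Space) : fderiv ℝ G X (Pi.single 0 u) = 0 := by
  rw [← hd.lineDeriv_eq_fderiv]
  have h : ∀ t : ℝ, G (X + t • (Pi.single (0 : Fin (m + 1)) u : Config (m + 1))) = G X := by
    intro t
    rw [← Pi.single_smul, add_single_zero_eq_update, hG]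
  unfold lineDeriv
  simp_rw [h]
  exact deriv_const 0 (G X)


end Summit.AtomisticToContinuum.BoseEinsteinCondensation.Theorems.FibreConductance.Negative

end
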